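import Summits.QuantumFields.YangMills.Theorems.UnitScaleTiltProp7ClosedPlaqFibreMinimiser
import Summits.QuantumFields.YangMills.Theorems.UnitScaleTiltProp7ClosedFibreHalving
import HarnessLib

/-!
# Route `UnitScaleTilt`, crux K1 child «MinimiserStabilityRegPr» (stmt-QuantumFields-19200), skeleton v10 {`stub_halvingStep`, `stub_existenceMinimalOrbit`} —
# THE EXISTENCE STUB ON ROUTE (β′): PLAQUETTE-ONLY CLOSED FIBRE AT ONE FIXED RADIUS, PROP. 8 DOES THE SHRINKING —
# `stub_existenceMinimalOrbit` ⇐ `landed_prop8` ∧ hPlₚ ∧ hDvₚ, BY NAME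

Cell `ym3-torus`, width seat `ym-ust-19200-w4` (gen 0; INTERIOR-sentence owner; re-cut (β′) adopted 2026-08-28 01:33Z with ★20520-w5 g0 (01:28:09Z) and ★20520-w2 g2).
Carrier: 20520-w4's plaquette-only closed fibre `(6̄ₚ)(R) ∩ 𝔅_k(V) = {∀ p, |U(∂p) − 1| ≤ R·L^{−2(K−n)}} ∩ 𝔅_k(V)` (`Prop7ClosedPlaqFibreMinimiser`, p593040: compact,
the Wilson action attains its minimum on it when a background lies in it).  THEOREMS ONLY (0 `def`, 0 `sorry`).  YM₃ on T³ is a ladder rung (R3), not the Clay problem;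
nothing here claims the stub, the crux, d = 4 or the mass gap.

WHY (β′) AND NOT (β).  Over the two-clause closed fibre `(6̄)(R)` BOTH clauses of (2) are inequality constraints and a minimiser on the divergence shell carries
Karush–Kuhn–Tucker multipliers on a second-order constraint with no sign structure against (5).  Over `(6̄ₚ)(R)` the ONLY constraints are the plaquette ones; once
the plaquette half holds at a minimiser `Ū`, `Ū` is a local minimiser ON THE FIBRE and satisfies the Euler–Lagrange EQUATION along every differentiable fibre curve
(`Prop7ClosedFibreEulerLagrange.lin_eq_zero_of_isMinOn_closedPlaqFibre_of_plaqInterior`), from which the divergence clause is a REGULARITY CONCLUSION of expected size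
`(C₁ε₁ + C₂R²)·L^{−3(K−n)} < R·L^{−3(K−n)}` ([Balaban1985Variational] (159)–(161), (10) p. 279; ★20520-w5's located size) — the SAME radius `R` serves both clauses, so
reading R2 feeds the registered Prop. 8 ∕ halving without an E–L-criticality variant.

THE TWO DISPLAYED INPUTS (texts of record for the assisting seats; outer binders as in `Prop7ClosedFibreInteriorAtR`):
* hPlₚ (★20520-w2 g2): every minimiser `Ū` of (5) over `(6̄ₚ)(R) ∩ 𝔅_k(V)` — ONE FIXED `R ≤ R₁(L, B₃)`, (7)-datum at `ε₁ ≤ a′₁(R)`, background `U₀ ∈ 𝔘_k(L³B₃ε₁) ∩ 𝔅_k(V)`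
  — has `PlaqSmall (regThreshold F n K R) Ū` (no plaquette on the shell; the L^∞ a-priori estimate);
* hDvₚ (★20520-w5 g0): such a minimiser WITH the plaquette half in hand has `DivSmall F n K R Ū` ((1.9) from (1.7) + criticality).

WHAT IS PROVED (ns `…Theorems.Prop7ClosedPlaqFibreInteriorAtR`).  ★★ `existenceMinimalOrbit_of_prop8_of_plaqHalves : <landed_prop8 text> → hPlₚ → hDvₚ →
<stub_existenceMinimalOrbit text verbatim>`: `R := min{a₅, R₁ᴾ, R₁ᴰ, r(L)}` (`a₅` of Prop. 8, `r(L)` (53)-admissible), `a″₁ := min{a′₁ᴾ(R), a′₁ᴰ(R), R/(L³B₃)}`; the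
direct method gives `Ū`; hPlₚ ∧ hDvₚ give `Ū ∈ 𝔘_k(R)`; `Prop7ClosedPlaqFibreMinimiser.isCritR2_of_plaqInterior` makes it R2-critical; Prop. 8 sends it into (8) =
`𝔘_k(B₃ε₁) ⊆ (6)(L³B₃ε₁) ⊆ (6̄ₚ)(R)`, over which it minimises (O₁ = 1); `Prop7ClosedFibreHalving.existenceMinimalOrbit_allB₃_of_one` spreads Prop. 8's `B₃` over all
`B₃ > 4`.

HONEST SCOPE.  Bookkeeping over p593040 and `Prop7ClosedFibreHalving`; hPlₚ, hDvₚ and Prop. 8 are displayed hypotheses; nothing of [Balaban1985Variational] is asserted;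
`--supports stmt-QuantumFields-19200`, count-neutral.

References: T. Bałaban, CMP 102 (1985) 277–309 [Balaban1985Variational] ((2) p.278, (10) p.279, (14) p.280, Prop. 7 p.299, Prop. 8 and (158)–(161) pp.302–304);
CMP 98 (1985) 17–51 [Balaban1985Averaging] ((53) p.26).
-/

set_option autoImplicit false

noncomputable section

namespace Summit.QuantumFields.YangMills.Theorems.Prop7ClosedPlaqFibreInteriorAtR

open Set
open scoped Matrix.Norms.L2Operator
open Literature.MathematicalPhysics.QuantumFieldTheory.Balaban1983to89
open Literature.MathematicalPhysics.QuantumFieldTheory.Balaban1983to89.T3ContinuumYM3Torus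
open Literature.MathematicalPhysics.QuantumFieldTheory.Balaban1983to89.T3UnitLawDensityEML (ℰp)
open Literature.MathematicalPhysics.QuantumFieldTheory.Balaban1983to89.T3PrintedRegularMinimiser (RegPr DivSmall regFibrePr mem_regFibrePr_iff)
open Literature.MathematicalPhysics.QuantumFieldTheory.Balaban1983to89.T3PrintedMinimiserExistence (regFibrePr_mono regPr_mono)
open Literature.MathematicalPhysics.QuantumFieldTheory.Balaban1983to89.T3RegularMinimiser (regThreshold)
open Literature.MathematicalPhysics.QuantumFieldTheory.Balaban1983to89.T3ConstrainedMinimiser (fibre)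
open Literature.MathematicalPhysics.QuantumFieldTheory.Balaban1983to89.T3TiltDescent (descendTo)
open Literature.MathematicalPhysics.QuantumFieldTheory.Balaban1983to89.T3Thm1CarrierNative (IsCritR2)
open Literature.MathematicalPhysics.QuantumFieldTheory.Balaban1983to89.ExpMeanLog (deltaSU deltaSU_pos)
open Summit.QuantumFields.YangMills.Theorems.Prop7ClosedFibreMinimiser (exists_isMinOn_closedPlaqFibre_of_background regFibrePr_subset_closedPlaqFibre
  isCritR2_of_plaqInterior)
open Summit.QuantumFields.YangMills.Theorems.Prop7ClosedFibreHalving (existenceMinimalOrbit_allB₃_of_one)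

/-- ★★ **`stub_existenceMinimalOrbit` ⇐ PROP. 8 ∧ hPlₚ ∧ hDvₚ** (route (β′): plaquette-only closed fibre, one fixed radius, Prop. 8 does the shrinking — see the
module docstring for the texts and the route). [cite: Balaban1985Variational, Prop. 7 p.299, Prop. 8 p.304, (14) p.280, (2) p.278] -/
theorem existenceMinimalOrbit_of_prop8_of_plaqHalves
    (hP8 : ∀ L : ℕ, 1 < L → ∃ B₃ : ℝ, 4 < B₃ ∧ B11.Prop8Printed B₃ (T3Thm1Carrier.famX L))
    (hPl : ∀ L : ℕ, 1 < L → ∀ B₃ : ℝ, 4 < B₃ → ∃ R₁ : ℝ, 0 < R₁ ∧ ∀ R : ℝ, 0 < R → R ≤ R₁ → ∃ a₁' : ℝ, 0 < a₁' ∧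
      ∀ F : T3Family, F.L = L → ∀ (n K : ℕ) (hnK : n < K) (ε₁ : ℝ), 0 < ε₁ → ε₁ ≤ a₁' →
        ∀ V : GaugeField (F.P n) 0 (Matrix.specialUnitaryGroup (Fin 2) ℂ), PlaqSmall ε₁ V →
          ∀ U₀ : GaugeField (F.P K) 0 (Matrix.specialUnitaryGroup (Fin 2) ℂ), RegPr F n K ((L : ℝ) ^ 3 * B₃ * ε₁) U₀ →
            U₀ ∈ fibre F ℰp n K hnK.le V →
            ∀ Ū : GaugeField (F.P K) 0 (Matrix.specialUnitaryGroup (Fin 2) ℂ),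
              Ū ∈ {U : GaugeField (F.P K) 0 (Matrix.specialUnitaryGroup (Fin 2) ℂ) | ∀ p : Plaq (F.P K) 0,
                  GaugeGroup.dist1 (GaugeField.plaqHol U p) ≤ regThreshold F n K R} ∩ descendTo F ℰp n K hnK.le ⁻¹' {V} →
              IsMinOn (fun W : GaugeField (F.P K) 0 (Matrix.specialUnitaryGroup (Fin 2) ℂ) => wilsonAction4 W)
                ({U : GaugeField (F.P K) 0 (Matrix.specialUnitaryGroup (Fin 2) ℂ) | ∀ p : Plaq (F.P K) 0,
                  GaugeGroup.dist1 (GaugeField.plaqHol U p) ≤ regThreshold F n K R} ∩ descendTo F ℰp n K hnK.le ⁻¹' {V}) Ū →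
              PlaqSmall (regThreshold F n K R) Ū)
    (hDv : ∀ L : ℕ, 1 < L → ∀ B₃ : ℝ, 4 < B₃ → ∃ R₁ : ℝ, 0 < R₁ ∧ ∀ R : ℝ, 0 < R → R ≤ R₁ → ∃ a₁' : ℝ, 0 < a₁' ∧
      ∀ F : T3Family, F.L = L → ∀ (n K : ℕ) (hnK : n < K) (ε₁ : ℝ), 0 < ε₁ → ε₁ ≤ a₁' →
        ∀ V : GaugeField (F.P n) 0 (Matrix.specialUnitaryGroup (Fin 2) ℂ), PlaqSmall ε₁ V →
          ∀ U₀ : GaugeField (F.P K) 0 (Matrix.specialUnitaryGroup (Fin 2) ℂ), RegPr F n K ((L : ℝ) ^ 3 * B₃ * ε₁) U₀ →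
            U₀ ∈ fibre F ℰp n K hnK.le V →
            ∀ Ū : GaugeField (F.P K) 0 (Matrix.specialUnitaryGroup (Fin 2) ℂ),
              Ū ∈ {U : GaugeField (F.P K) 0 (Matrix.specialUnitaryGroup (Fin 2) ℂ) | ∀ p : Plaq (F.P K) 0,
                  GaugeGroup.dist1 (GaugeField.plaqHol U p) ≤ regThreshold F n K R} ∩ descendTo F ℰp n K hnK.le ⁻¹' {V} →
              IsMinOn (fun W : GaugeField (F.P K) 0 (Matrix.specialUnitaryGroup (Fin 2) ℂ) => wilsonAction4 W)
                ({U : GaugeField (F.P K) 0 (Matrix.specialUnitaryGroup (Fin 2) ℂ) | ∀ p : Plaq (F.P K) 0,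
                  GaugeGroup.dist1 (GaugeField.plaqHol U p) ≤ regThreshold F n K R} ∩ descendTo F ℰp n K hnK.le ⁻¹' {V}) Ū →
              PlaqSmall (regThreshold F n K R) Ū →
              DivSmall F n K R Ū) :
    ∀ L : ℕ, 1 < L → ∀ B₃ : ℝ, 4 < B₃ → ∃ a₁' O₁ : ℝ, 0 < a₁' ∧ 1 ≤ O₁ ∧
      ∀ F : T3Family, F.L = L → ∀ (n K : ℕ) (hnK : n < K) (ε₁ : ℝ), 0 < ε₁ →
        ∀ V : GaugeField (F.P n) 0 (Matrix.specialUnitaryGroup (Fin 2) ℂ), PlaqSmall ε₁ V →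
          ∀ U₀ : GaugeField (F.P K) 0 (Matrix.specialUnitaryGroup (Fin 2) ℂ), RegPr F n K ((L : ℝ) ^ 3 * B₃ * ε₁) U₀ →
            U₀ ∈ fibre F ℰp n K hnK.le V → ε₁ ≤ a₁' →
              ∃ U ∈ regFibrePr F n K hnK.le (O₁ * (L : ℝ) ^ 3 * B₃ * ε₁) V,
                IsMinOn (fun W : GaugeField (F.P K) 0 (Matrix.specialUnitaryGroup (Fin 2) ℂ) => wilsonAction4 W)
                  (regFibrePr F n K hnK.le (O₁ * (L : ℝ) ^ 3 * B₃ * ε₁) V) U := by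
  refine existenceMinimalOrbit_allB₃_of_one fun L hL => ?_
  obtain ⟨B₃, hB₃, hP⟩ := hP8 L hL
  have hB₃0 : 0 < B₃ := by linarith
  obtain ⟨a₅, ha₅, HP8⟩ := T3Thm1CarrierNative.prop8Printed_famX_iff_native.mp hP
  obtain ⟨R₁, hR₁, HPL⟩ := hPl L hL B₃ hB₃
  obtain ⟨R₂, hR₂, HDV⟩ := hDv L hL B₃ hB₃
  -- an admissible radius `r(L)` ([Balaban1985Averaging] (53), as in p591314 §4)
  set C : ℝ := 143 * ((((3 + 4 : ℕ) : ℝ)) ^ 2 / 4) ^ 2 with hC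
  set M : ℝ := (((3 + 4) * L : ℕ) : ℝ) ^ 2 with hM
  have hCpos : 0 < C := by rw [hC]; positivity
  have hLpos : (0 : ℝ) < L := by exact_mod_cast (by omega : 0 < L)
  have hMpos : 0 < M := by
    rw [hM]
    have : (0 : ℝ) < (((3 + 4) * L : ℕ) : ℝ) := by push_cast; positivity
    positivity
  have hδ := deltaSU_pos (n := Fin 2)
  set r : ℝ := min (1 / (6 * C)) (deltaSU (Fin 2) / (2 * M)) with hr_def
  have hr : 0 < r := lt_min (by positivity) (by positivity)
  have hr3 : C * (2 * r) ≤ 1 / 3 := by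
    calc C * (2 * r) ≤ C * (2 * (1 / (6 * C))) := by gcongr; exact min_le_left _ _
      _ = 1 / 3 := by field_simp; ring
  have hr2 : 2 * (2 * r) ≤ 2 * deltaSU (Fin 2) / M := by
    calc 2 * (2 * r) ≤ 2 * (2 * (deltaSU (Fin 2) / (2 * M))) := by gcongr; exact min_le_right _ _
      _ = 2 * deltaSU (Fin 2) / M := by field_simp
  -- the ONE radius and the constant
  set R : ℝ := min a₅ (min (min R₁ R₂) r) with hR_def
  have hR : 0 < R := lt_min ha₅ (lt_min (lt_min hR₁ hR₂) hr)
  have hRa₅ : R ≤ a₅ := min_le_left _ _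
  have hRR₁ : R ≤ R₁ := ((min_le_right _ _).trans (min_le_left _ _)).trans (min_le_left _ _)
  have hRR₂ : R ≤ R₂ := ((min_le_right _ _).trans (min_le_left _ _)).trans (min_le_right _ _)
  have hRr : R ≤ r := (min_le_right _ _).trans (min_le_right _ _)
  obtain ⟨a₁, ha₁, HPL'⟩ := HPL R hR hRR₁
  obtain ⟨a₂, ha₂, HDV'⟩ := HDV R hR hRR₂
  have hD : 0 < (L : ℝ) ^ 3 * B₃ := by positivity
  refine ⟨B₃, min (min a₁ a₂) (R / ((L : ℝ) ^ 3 * B₃)), 1, hB₃0, lt_min (lt_min ha₁ ha₂) (div_pos hR hD), le_rfl,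
    fun F hF n K hnK ε₁ hε₁ V hV U₀ hreg hfib hε₁a => ?_⟩
  subst hF
  have hε₁a₁ : ε₁ ≤ a₁ := (hε₁a.trans (min_le_left _ _)).trans (min_le_left _ _)
  have hε₁a₂ : ε₁ ≤ a₂ := (hε₁a.trans (min_le_left _ _)).trans (min_le_right _ _)
  have hwin : (F.L : ℝ) ^ 3 * B₃ * ε₁ ≤ R := by
    have h1 : ε₁ ≤ R / ((F.L : ℝ) ^ 3 * B₃) := hε₁a.trans (min_le_right _ _)
    rw [le_div_iff₀ hD] at h1
    linarith
  obtain ⟨Ū, hŪ, hmin, -, -⟩ := exists_isMinOn_closedPlaqFibre_of_background F hnK.le hr hr3 hr2 hwin hRr hreg hfib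
  have hpl : PlaqSmall (regThreshold F n K R) Ū := HPL' F rfl n K hnK ε₁ hε₁ hε₁a₁ V hV U₀ hreg hfib Ū hŪ hmin
  have hdv : DivSmall F n K R Ū := HDV' F rfl n K hnK ε₁ hε₁ hε₁a₂ V hV U₀ hreg hfib Ū hŪ hmin hpl
  have hint : RegPr F n K R Ū := ⟨hpl, hdv⟩
  have hcrit : IsCritR2 F n K hnK.le V Ū := isCritR2_of_plaqInterior F hnK.le hR hmin hŪ.2 hint
  have h8 : RegPr F n K (B₃ * ε₁) Ū := HP8 F rfl n K hnK R ε₁ hε₁ hRa₅ V Ū hV hint hŪ.2 hcrit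
  have hL3 : (1 : ℝ) ≤ (F.L : ℝ) ^ 3 := one_le_pow₀ (by exact_mod_cast (by omega : 1 ≤ F.L))
  have hB8 : B₃ * ε₁ ≤ 1 * (F.L : ℝ) ^ 3 * B₃ * ε₁ := by
    have : 0 ≤ B₃ * ε₁ := by positivity
    nlinarith
  have h1R : 1 * (F.L : ℝ) ^ 3 * B₃ * ε₁ ≤ R := by linarith
  refine ⟨Ū, (mem_regFibrePr_iff F).2 ⟨hŪ.2, regPr_mono F hB8 h8⟩, ?_⟩
  exact hmin.on_subset ((regFibrePr_mono F h1R V).trans (regFibrePr_subset_closedPlaqFibre F hnK.le R V))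

end Summit.QuantumFields.YangMills.Theorems.Prop7ClosedPlaqFibreInteriorAtR

end
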